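import Summits.QuantumFields.YangMills.Theorems.FiniteRankMirrorMirrorPeeling
import Summits.QuantumFields.YangMills.Theses.StaticSourceWitness
import HarnessLib

/-!
# Route `StaticSourceWitness`, LINE g9-2 «ratio peeling» — the shared support item `MirrorPeeling`

Ideator seat ym-idea-8 (generation 9).  The support item `StaticSourceWitness.MirrorPeeling` (mirror Markov peeling:
`|E_T[(F₁∘Θ)F₂] − E_T F₁·E_T F₂| ≤ 2‖E[F₁|∂Q] − p₁‖₂·‖E[F₂|∂Q] − p₂‖₂` for bounded continuous cylinder observables in
one positive-time window cube) has the same statement as `FiniteRankMirror.MirrorPeeling` (stmt-QuantumFields-23848),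
proved in `Theorems/FiniteRankMirrorMirrorPeeling`; this file records the identification for the route
`StaticSourceWitness`.

HONEST FRAMING: folklore DLR bookkeeping; no summit is proved by this line; not Clay.
-/

/-- Item `MirrorPeeling` of route `StaticSourceWitness` (same statement as `FiniteRankMirror.MirrorPeeling`). [folklore] -/
theorem Summit.QuantumFields.YangMills.Theorems.staticSourceWitness_mirrorPeeling :
    Summit.QuantumFields.YangMills.Theses.StaticSourceWitness.MirrorPeeling :=
  Summit.QuantumFields.YangMills.Theorems.finiteRankMirror_mirrorPeeling
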